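import Summits.QuantumFields.YangMills.Theses.MirrorModularBoosts
import Literature.MathematicalPhysics.QuantumFieldTheory.OSReconstructionNoE1Proofs

/-!
# Line `positivity-disc-to-operator-cone` — skeleton for crux `MirrorModularBoosts.PlanarSpectralCone`
# (stmt-QuantumFields-9664, route-QuantumFields-MirrorModularBoosts)

**Idea** (crux-idea card `Cruxes/PlanarSpectralCone/Ideas/positivity-disc-to-operator-cone.md`,
triage r1-1/2/3: pass ×3, "back end of the one SCV line"). The crux asks, for a one-species family
`S` on `ℝ⁴` with E0', E3, translations on `⁰𝒮` and reflection positivity in the eight frames of the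
`(x₀,x₁)`-plane, for the typed planar spectral cone: `(ζ, β) ↦ ⟪Ψ_F, e^{-ζH+iβP₁} Ψ_G⟫` holomorphic
on the tube `{|Im β| < Re ζ}` with the Cauchy–Schwarz bound. The two DIAGONAL mirrors only give, at
real `ζ = t`, the DISC `|β| < t` (cdisprove `cross_slice_iff_disc`; refuter g41-34), and only for
pairs supported in cone chains. The lever of this line: the diagonal matrix element
`g_G(t,b) = ⟪Ψ_G, e^{-tH} U(b e₁) Ψ_G⟫ = ∫ e^{-tp₀+ibp₁} dμ_G` is the Fourier–Laplace transform of a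
POSITIVE measure (the joint spectral measure of `(H, P⃗)`, `OSReconstructionNoE1`, whose existence
`exists_isJointSpectralMeasure_holds` is proved in the tree), so
(1) Landau–Pringsheim/Lukacs upgrades disc holomorphy to the strip with the monotone bound
`|g(t, b+iσ)| ≤ g(t, iσ) ≤ M`; (2) boundedness along boost rays after an arbitrary delay forces
`μ_G{p₀ < |p₁|} = 0` (cdisprove's PROVED `cone_of_laplace_bound` is the undelayed case);
(3) null sets of joint spectral measures pass to the closed span (PVM linearity), so cone support
for the cone-chain vectors (dense: stub 3) gives the operator cone `H ≥ |P₁|` = the Transfer `C⁺`,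
from which the typed statement for ALL time-ordered `F, G` follows (stub 5).

**Shape.** Five stubs `stub_*` (the only `sorry`s): 1 `stub_discSections` (front end = the merged
slot cards `two-mirror-lightcone-slots ≈ lightcone-sector-engine`: disc sections with `t`-uniform
bound for cone-chain diagonal pairs), 2 `stub_cone_of_discSections` (THE LEVER, pure measure
theory on `ℝ⁴`: disc ⇒ strip ⇒ cone by positivity), 3 `stub_density` (card
`cone-ordered-density-holomorphic-gaps`: cone-chain field vectors span a dense subspace),
4 `stub_linearity` (null sets of joint spectral measures pass to the closed linear span),
5 `stub_transfer` (`C⁺ ⇒` the typed conclusion). Sorry-free glue: `osReconstruction_e0` (the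
`e₀`-frame OS space from the frame `R = 1`), `planarConeSupport_of_parts` (ARROW FORM: stubs 1–4 as
hypotheses ⇒ `C⁺`), and `PlanarSpectralCone_of : MirrorModularBoosts.PlanarSpectralCone` (the crux
BY NAME, no hypotheses; uses the five stubs and nothing else that is sorried). All statements are
over existing tree declarations only (no local `def`).

**Disproof used** (cdisprove `Disproof.lean` v1–v3 on stmt-9664, 2026-08-15, via its evidence notes —
the file path `run/gate/evidence/…` is not mounted on this hub and `ledger crux cat … Disproof.lean`
answers "no crux workfile"): `false_without_diagonalFrames` — honoured at `stub_discSections`, the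
only consumer of the frames `a² = b² = 1/2`; `false_without_translation` — `htr` feeds
`osReconstruction_e0` (glue) and the diagonal-frame reconstructions inside stubs 1 and 3;
`false_without_axisFrames` — the `e₀`-frame E2 (frame `R = 1`) is consumed by `osReconstruction_e0`;
`sharpened_implies_crux` — consistent: the `±e₁` and backward frames and E0' are idle here too
(passed to stubs 1, 3 only as available hypotheses); `cross_slice_iff_disc` — is WHY stub 1 delivers
discs and stub 2 exists; `cone_of_laplace_bound` (proved there, §5b) — the undelayed half of stub 2,
to be ported; `crux_at_zero` / `crux_at_vacuumOnly` / `Concl.real_bound` — degenerate `n = 0`,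
`m = 0`, `S = 0` cases live inside stub 5 (constant `Φ`, 2×2 Gram bound, no normalisation used).
No `Negative/` lemma has landed for this crux (lane closed to refuters) — nothing to import.
-/

noncomputable section

namespace Summit.QuantumFields.YangMills.Cruxes.PlanarSpectralCone.PositivityDiscToOperatorCone

open MeasureTheory
open scoped InnerProductSpace SchwartzMap
open Literature.MathematicalPhysics.QuantumLattice Literature.MathematicalPhysics.AQFT
  Literature.MathematicalPhysics.QuantumFieldTheory

/-- Euclidean `ℝ⁴`, time = coordinate `0`, the boost plane = coordinates `0, 1`. -/
local notation "E4" => EuclideanSpace ℝ (Fin 4)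

/-! ## The five stubs

Vocabulary used VERBATIM in several stubs (kept inline so that every statement is over existing
declarations; the glue relies on the texts agreeing):

* *crux hypotheses* on `S : SchwingerFamily E4`: `S.toLabelled.HasLinearGrowth` (E0'),
  `S.toLabelled.IsSymmetric` (E3), translation invariance on `⁰𝒮`
  `∀ n a F, IsOffDiagonal F → S n (translateMulti a F) = S n F`, and eight-frame E2
  `∀ R a b, a²+b² = 1 → (a = 0 ∨ b = 0 ∨ a² = b²) → R e₀ = a e₀ + b e₁ → (S ∘ linActMulti R).IsRP`;
* *strict cone chain* (`m`-point test function `G`):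
  `tsupport G ⊆ {x | (∀ i, |x i 1| < x i 0) ∧ ∀ i j, i < j → |x j 1 - x i 1| < x j 0 - x i 0}` —
  all points and all differences in the open wedge `W = {|x₁| < x₀}` bounded by the two DIAGONAL
  mirrors; such `G` is time-ordered along `e₀` and, after the plane rotations `R_{±90°}`, along both
  diagonal normals `(e₀ ± e₁)/√2` (triage F2);
* *disc sections with delay `c ≥ 0` and bound `M`* of `ψ` in the `e₀`-OS space `h`:
  `∀ t > c, ∃ f` holomorphic on `Metric.ball 0 (t - c)`, `‖f‖ ≤ M` there, and
  `f b = ⟪ψ, h.transfer t (h.translate (b e₁) ψ)⟫` for real `|b| < t - c`;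
* *planar cone support* (`C⁺`): `∀ ψ μ, h.IsJointSpectralMeasure ψ μ → μ {p | p 0 < |p 1|} = 0`.
-/

/-- **Stub 1 — FRONT END: disc sections for cone-chain diagonal pairs** (cards
`two-mirror-lightcone-slots` ≈ `lightcone-sector-engine`, the input this line consumes). For `S`
with the crux hypotheses, `h` its `e₀`-OS reconstruction and `G` a strict cone chain, the diagonal
matrix element `b ↦ ⟪Ψ_G, e^{-tH} U(b e₁) Ψ_G⟫ = 𝔖_{2m}(ΘG* ⊗ G_{t e₀ + b e₁})` has disc sections with
some delay `c ≥ 0` and a `t`-UNIFORM bound `M` (in fact `c = 0`, `M = max(‖Ψ_G‖², ‖Ψⁿ_A‖‖Ψⁿ_G‖,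
‖Ψⁿ'_{A'}‖‖Ψⁿ'_G‖)` work). Why true: with `n, n' = (e₀ ± e₁)/√2` and `a = u n + u' n'`,
`φ(u,u') = 𝔖(ΘG* ⊗ G_a)` has slot 1 = `⟪Ψⁿ_A, e^{-uHₙ} Uₙ(u'n') Ψⁿ_G⟫ₙ` in the OS space of the
pulled-back family `S ∘ linActMulti R₊` (`R₊ e₀ = n`, E2 from `hRP` at `a = b = 1/√2`, translation
invariance from `htr` via `linActMulti_translateMulti`; `Θ₀G* = Θₙ A*` with `A = G ∘ R₉₀⁻¹`
n-ordered because `R₉₀ W ⊂ {x₁ > |x₀|}`), slot 2 likewise with `n'` (`a = -b = 1/√2`), both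
holomorphic and bounded on the whole right half-plane, base values bounded by `‖Ψ_G‖²`
(`a ∈ W` for `u, u' > 0`); this is `LogSlot.IsSectorData (π/2) … C 0 (fun _ => C)`, so
`IsSectorData.exists_extension` + `norm_extension_le` (PROVED: triage W1.lean /
TRIAGE-r1-3-TwoSlot.lean `twoSlot_sector_extension_sharp`) extend `φ` to `sectorRegion 1 (π/2)` with
the same bound, and `(u,u') = ((t+β)/√2, (t-β)/√2)` lies in that region iff `|β| < t`
(cdisprove `cross_slice_iff_disc`, TRIAGE-r1-3-Thales.lean) — the DISC; at real `|b| < t` the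
point is in the open quadrant where the extension equals `φ(te₀+be₁) = ⟪Ψ_G, T(t)U(be₁)Ψ_G⟫`
(`inner_fieldVec_fieldVec`, `transfer_fieldVec`, `translate_fieldVec`, `translateMulti_translateMulti`).
Weaker than the crux (crux ⇒ strip sections ⊃ disc sections). Uses the two DIAGONAL frames
(honours cdisprove `false_without_diagonalFrames`) and translations; `hlg`, `hsym` are passed but
believed idle (cdisprove `sharpened_implies_crux`). Size L (frame bookkeeping for two pulled-back
reconstructions + complex-time matrix elements of their semigroups + the proved engine). -/
theorem stub_discSections (S : SchwingerFamily E4)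
    (hlg : S.toLabelled.HasLinearGrowth) (hsym : S.toLabelled.IsSymmetric)
    (htr : ∀ (n : ℕ) (a : E4) (F : 𝓢((Fin n → E4), ℂ)), IsOffDiagonal F →
      S n (translateMulti a F) = S n F)
    (hRP : ∀ (R : E4 ≃ₗᵢ[ℝ] E4) (a b : ℝ), a ^ 2 + b ^ 2 = 1 → (a = 0 ∨ b = 0 ∨ a ^ 2 = b ^ 2) →
      R (EuclideanSpace.single 0 1) = a • EuclideanSpace.single 0 1 + b • EuclideanSpace.single 1 1 →
        (SchwingerFamily.toLabelled (fun n => (S n).comp (linActMulti R))).IsReflectionPositive)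
    (h : OSReconstructionNoE1 S.toLabelled) {m : ℕ} (G : 𝓢((Fin m → E4), ℂ)) (hG : IsTimeOrdered G)
    (hC : tsupport (G : (Fin m → E4) → ℂ) ⊆
      {x | (∀ i, |x i 1| < x i 0) ∧ ∀ i j, i < j → |x j 1 - x i 1| < x j 0 - x i 0}) :
    ∃ c M : ℝ, 0 ≤ c ∧ ∀ t : ℝ, c < t → ∃ f : ℂ → ℂ,
      DifferentiableOn ℂ f (Metric.ball 0 (t - c)) ∧
        (∀ z ∈ Metric.ball (0 : ℂ) (t - c), ‖f z‖ ≤ M) ∧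
          ∀ b : ℝ, |b| < t - c →
            f b = ⟪h.fieldVec m (fun _ => ()) G hG, h.transfer t
              (h.translate (EuclideanSpace.single 1 b) (h.fieldVec m (fun _ => ()) G hG))⟫_ℂ := by
  sorry

/-- **Stub 2 — THE LEVER: disc ⇒ strip ⇒ cone by positivity** (pure measure theory on `ℝ⁴`; the
card's steps (1)+(2)). A finite positive measure `μ` on energy–momentum space carried by `{p₀ ≥ 0}`
whose Fourier–Laplace sections `b ↦ ∫ e^{-tp₀+ibp₁} dμ`, for every `t > c`, are restrictions of
functions holomorphic on the disc `|β| < t - c` and bounded there by ONE constant `M`, charges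
nothing outside the closed planar cone: `μ{p₀ < |p₁|} = 0`. Why true: (1) Landau–Pringsheim /
Lukacs (Characteristic Functions, 2nd ed. 1970, Thm 7.1.1, §7.2): for `ν_t := (p ↦ p₁)_*(e^{-tp₀}μ)`
the characteristic function agrees on `(-r, r)`, `r = t - c`, with `f` analytic on the disc, so all
even moments `m_{2k} = (-1)^k f^{(2k)}(0)` exist (Fatou on symmetric difference quotients) and
`∫ cosh(σp₁) dν_t = Σ m_{2k} σ^{2k}/(2k)! < ∞` for `|σ| < r` by the Cauchy estimates
`|f^{(n)}(0)| ≤ M n!/r'^n`; hence the characteristic function is holomorphic on the strip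
`|Im β| < r`, equals `f` on the disc (identity theorem), and `f(iσ) = ∫ e^{-tp₀-σp₁} dμ ≤ M`;
(2) ray asymptotics (cdisprove's PROVED `cone_of_laplace_bound`, §5b of Disproof.lean v3, is the
case `c = 0`; port it): on `{κp₁ - p₀ > δ, 0 < p₁ ≤ L}` with `σ = κ(t-c)` the integrand is
`≥ e^{tδ - κcL}`, so that set is null for every `κ < 1, δ > 0, L`; countable unions and `p₁ ↦ -p₁`
give `{p₀ < |p₁|} ⊆ {p₀ < 0} ∪ ⋃ …` null. Delay-tolerant and constant-blind, as the card says
(μ of `e^{-sH}ψ` is `e^{-2sp₀}μ_ψ`). Cheapest falsifier checked (card + triage): an atom `(E₀,p)`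
with `|p| > E₀` has entire sections but violates every `t`-uniform bound on rays `κ > E₀/|p|`.
Size M (Lukacs is not in Mathlib: `charFun`, `iteratedDeriv`, `integral_exp_pos`-type monotone
convergence; the ray half is ~60 lines). -/
theorem stub_cone_of_discSections (μ : Measure E4) [IsFiniteMeasure μ]
    (hE : μ {p | p 0 < 0} = 0) (c M : ℝ) (hc : 0 ≤ c)
    (hdisc : ∀ t : ℝ, c < t → ∃ f : ℂ → ℂ,
      DifferentiableOn ℂ f (Metric.ball 0 (t - c)) ∧
        (∀ z ∈ Metric.ball (0 : ℂ) (t - c), ‖f z‖ ≤ M) ∧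
          ∀ b : ℝ, |b| < t - c →
            f b = ∫ p, Complex.exp ((((-(t * p 0) : ℝ)) : ℂ) + ((b * p 1 : ℝ) : ℂ) * Complex.I) ∂μ) :
    μ {p | p 0 < |p 1|} = 0 := by
  sorry

/-! ### Stub 3 — DENSITY of cone-chain vectors, RESHAPED (second lead, 2026-08-16) into
`stub_oneGap` (the analytic heart: one-gap holomorphic vectors from a 2-slot Gram kernel),
`stub_windowedDensity` (pure Schwartz-space density of windowed tensor products among time-ordered
test functions) and `stub_density_of_parts` (arrow form: first-gap absorption + the gap-by-gap
induction over windowed products + the closure argument), composed below into the original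
statement `stub_density` (now glue). No E0'/E3 is used by any of the three. -/

/-- **Stub 3a — ONE GAP: holomorphic gap-stretching of a level-separated pair** (the analytic heart
of the density half; OS II Ch. V at ONE gap, E1-free). Let `P` (`k` points) and `Q` (`l` points) be
time-ordered with `P` supported at times `< T` and `Q` at times `> T`, and put
`Ψ(s) = Ψ_{P ⊗ Q_{s e₀}}` (`s ≥ 0`; the appended tensor is time-ordered). If a vector `χ` of the
`e₀`-OS space is orthogonal to `Ψ(s)` for all `s ≥ s₀`, then it is orthogonal to `Ψ(s)` for ALL
`s ≥ 0`. Why true: the Gram kernel `K(s,s') = ⟪Ψ(s), Ψ(s')⟫ = 𝔖(Θ(P⊗Q_s)* ⊗ P ⊗ Q_{s'})` is,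
after translating every point by `(T+s)e₀` (translation invariance on `⁰𝒮`; the mirror re-centred
at level `T`), `⟪Ψ_{Q_{-T}}, e^{-sH} Ψ_{R(s')}⟫` with the time-ordered
`R(s') = (ΘP* ⊗ P ⊗ Q_{s'})_{+T e₀}`, and symmetrically `⟪Ψ_{R(s)}, e^{-s'H} Ψ_{Q_{-T}}⟫`; so `K`
is 2-slot sector data of opening `π/2` (`LogSlot.IsSectorData`, slots = complex-time matrix
elements `⟪ψ, e^{-τH} ψ'⟫` from polarised joint spectral measures, polynomial growth in the real
gap from the temperedness of the single distribution `𝔖_{2k+2l}`), the tree engine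
`IsSectorData.exists_extension` continues it to the sector region, `exists_holomorphic_gramVec`
(`OSHolomorphicVectors`, `m = 1`) turns `s ↦ Ψ(s)` into the restriction of a holomorphic `ℋ`-valued
map on a complex neighbourhood of `(0,∞)`, `z ↦ ⟪χ, Ψ(z)⟫` vanishes on `[s₀,∞)` hence on `(0,∞)`
(identity theorem), and at `s = 0` by continuity of translations. Size L. HELD BY THE LEAD. -/
theorem stub_oneGap (S : SchwingerFamily E4) (h : OSReconstructionNoE1 S.toLabelled)
    {k l : ℕ} (P : 𝓢((Fin k → E4), ℂ)) (Q : 𝓢((Fin l → E4), ℂ)) (T : ℝ)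
    (hP : IsTimeOrdered P) (hQ : IsTimeOrdered Q)
    (hPT : tsupport (P : (Fin k → E4) → ℂ) ⊆ {x | ∀ i, x i 0 < T})
    (hQT : tsupport (Q : (Fin l → E4) → ℂ) ⊆ {x | ∀ i, T < x i 0})
    (χ : h.Hilbert) (s₀ : ℝ)
    (hχ : ∀ s : ℝ, s₀ ≤ s → 0 ≤ s →
      ∀ hs : IsTimeOrdered (P.appendTensor (translateMulti (SchwingerFamily.timeVec s) Q)),
        ⟪χ, h.fieldVec (k + l) (fun _ => ()) _ hs⟫_ℂ = 0)
    (s : ℝ) (hs0 : 0 ≤ s)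
    (hs : IsTimeOrdered (P.appendTensor (translateMulti (SchwingerFamily.timeVec s) Q))) :
    ⟪χ, h.fieldVec (k + l) (fun _ => ()) _ hs⟫_ℂ = 0 := by
  sorry

/-- **Stub 3b — WINDOWED DENSITY: windowed tensor products span the time-ordered test functions**
(pure Schwartz-space statement, no Schwinger functions). Every time-ordered `n`-point test function
(`tsupport F ⊆ {0 < x₁⁰ < ⋯ < xₙ⁰}`) lies in the closure (Schwartz topology) of the `ℂ`-span of the
WINDOWED TENSOR PRODUCTS `G = f₁ ⊗ ⋯ ⊗ fₙ` whose factors are supported in slabs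
`{aᵢ ≤ x⁰ ≤ bᵢ, |x¹| ≤ ρ}` with `0 < aᵢ` and `bᵢ < aⱼ` for `i < j`. Why true: compact cutoffs
`F χ_R → F` in `𝓢` with supports inside `tsupport F ∩ B̄_R`
(`QuantumLattice.exists_tsupport_subset_inter_closedBall_tendsto`), a compact subset of the OPEN
chamber; a scaled lattice partition of unity (`QuantumLattice.latticeBump`, `SchwartzPartition` /
`SchwartzLocalDensity`) of mesh below the distance to the chamber walls splits it into finitely many
pieces each supported in a closed box strictly inside an open ORDERED box (per-point time windows
pairwise ordered, bounded spatial sides); each piece is in the closed span of that box's tensor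
products (`QuantumLattice.mem_closure_span_boxTensors`, `Λ = id`), and box tensors are windowed
tensor products. Size M/L. -/
theorem stub_windowedDensity {n : ℕ} (F : 𝓢((Fin n → E4), ℂ)) (hF : IsTimeOrdered F) :
    F ∈ closure ((Submodule.span ℂ
      {G : 𝓢((Fin n → E4), ℂ) | ∃ (f : Fin n → 𝓢(E4, ℂ)) (a b : Fin n → ℝ) (ρ : ℝ),
        (∀ i, 0 < a i) ∧ (∀ i j, i < j → b i < a j) ∧
        (∀ i, tsupport (f i : E4 → ℂ) ⊆ {x | a i ≤ x 0 ∧ x 0 ≤ b i ∧ |x 1| ≤ ρ}) ∧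
        IsTensorOf G f} : Submodule ℂ 𝓢((Fin n → E4), ℂ)) : Set 𝓢((Fin n → E4), ℂ)) := by
  sorry

/-- **Stub 3c — DENSITY FROM THE GAP LEMMAS (arrow form: one-gap lemma + windowed density ⇒
density of cone-chain vectors).** With the statements of `stub_oneGap` and `stub_windowedDensity` as
HYPOTHESES (verbatim), the cone-chain field vectors span a dense subspace of the `e₀`-OS space.
Why true: let `χ ⊥ Ψ_G` for every strict cone chain `G`. (i) FIRST GAP (engine-free, drefuter
`DrefuteG2FirstGap.inner_fieldVec_eq_zero_of_internallyConed` on the crux, sorry-free): if `F` is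
time-ordered, internally coned (`|xⱼ¹ - xᵢ¹| < xⱼ⁰ - xᵢ⁰` for `i < j`) with `|xᵢ¹| ≤ D`, then
`e^{-sH}Ψ_F = Ψ_{F_{se₀}}` is a cone-chain vector for `s > max D 0`, and `s ↦ ⟪χ, e^{-sH}Ψ_F⟫` is
holomorphic on `Re s > 0`, continuous at `0`, so `χ ⊥ Ψ_F`. (ii) INDUCTION OVER GAPS: a windowed
tensor product all of whose gaps are wide (`aᵢ₊₁ - bᵢ > 2ρ`) is internally coned with `|x¹| ≤ ρ`,
so `χ ⊥` it by (i); if `χ ⊥` every windowed product whose gaps `> j` are wide, then for one whose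
gaps `> j+1` are wide split `G = P ⊗ Q` at gap `j+1` (`P` = first `j+1` factors, times `< T`,
`Q` = the rest, times `> T`): `P ⊗ Q_{se₀}` has all gaps `> j` wide once `s ≥ 2ρ`, hence `χ ⊥` it,
and `h_oneGap` gives `χ ⊥ P ⊗ Q_{0} = G`. (iii) CLOSURE: `G ↦ Ψ_G` is linear and continuous on
time-ordered test functions (`Ψ_{F+G} = Ψ_F + Ψ_G`, `‖Ψ_F‖² = Re 𝔖(ΘF*⊗F)`; drefuter
`DrefuteG4DensityAPI`), so by `h_wd` `χ ⊥ Ψ_F` for every time-ordered `F`, and the `Ψ_F` are total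
(`denseRange_vec`, `vec_eq_sum_genVec`), so `χ = 0`; `Dense` via
`Submodule.dense_iff_topologicalClosure_eq_top`. `hlg`, `hsym` idle. Size L (bookkeeping). -/
theorem stub_density_of_parts
    (h_oneGap : ∀ (S : SchwingerFamily E4) (h : OSReconstructionNoE1 S.toLabelled)
      {k l : ℕ} (P : 𝓢((Fin k → E4), ℂ)) (Q : 𝓢((Fin l → E4), ℂ)) (T : ℝ),
      IsTimeOrdered P → IsTimeOrdered Q →
      tsupport (P : (Fin k → E4) → ℂ) ⊆ {x | ∀ i, x i 0 < T} →
      tsupport (Q : (Fin l → E4) → ℂ) ⊆ {x | ∀ i, T < x i 0} →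
      ∀ (χ : h.Hilbert) (s₀ : ℝ),
      (∀ s : ℝ, s₀ ≤ s → 0 ≤ s →
        ∀ hs : IsTimeOrdered (P.appendTensor (translateMulti (SchwingerFamily.timeVec s) Q)),
          ⟪χ, h.fieldVec (k + l) (fun _ => ()) _ hs⟫_ℂ = 0) →
      ∀ (s : ℝ), 0 ≤ s →
        ∀ hs : IsTimeOrdered (P.appendTensor (translateMulti (SchwingerFamily.timeVec s) Q)),
          ⟪χ, h.fieldVec (k + l) (fun _ => ()) _ hs⟫_ℂ = 0)
    (h_wd : ∀ {n : ℕ} (F : 𝓢((Fin n → E4), ℂ)), IsTimeOrdered F →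
      F ∈ closure ((Submodule.span ℂ
        {G : 𝓢((Fin n → E4), ℂ) | ∃ (f : Fin n → 𝓢(E4, ℂ)) (a b : Fin n → ℝ) (ρ : ℝ),
          (∀ i, 0 < a i) ∧ (∀ i j, i < j → b i < a j) ∧
          (∀ i, tsupport (f i : E4 → ℂ) ⊆ {x | a i ≤ x 0 ∧ x 0 ≤ b i ∧ |x 1| ≤ ρ}) ∧
          IsTensorOf G f} : Submodule ℂ 𝓢((Fin n → E4), ℂ)) : Set 𝓢((Fin n → E4), ℂ)))
    (S : SchwingerFamily E4) (hlg : S.toLabelled.HasLinearGrowth)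
    (hsym : S.toLabelled.IsSymmetric) (h : OSReconstructionNoE1 S.toLabelled) :
    Dense ((Submodule.span ℂ
      {ψ : h.Hilbert | ∃ (m : ℕ) (G : 𝓢((Fin m → E4), ℂ)) (hG : IsTimeOrdered G),
        tsupport (G : (Fin m → E4) → ℂ) ⊆
          {x | (∀ i, |x i 1| < x i 0) ∧ ∀ i j, i < j → |x j 1 - x i 1| < x j 0 - x i 0} ∧
        ψ = h.fieldVec m (fun _ => ()) G hG} : Submodule ℂ h.Hilbert) : Set h.Hilbert) := by
  sorry

/-- **DENSITY of cone-chain vectors** (the original stub 3 of the line, now GLUE): composition of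
`stub_density_of_parts` with `stub_oneGap` and `stub_windowedDensity`. In the `e₀`-OS space of a
family with E2 and translations on `⁰𝒮`, the field vectors `Ψ_G` of strict cone chains `G` (all
arities) span a dense subspace. (`hlg`, `hsym` are passed through and idle.) -/
theorem stub_density (S : SchwingerFamily E4) (hlg : S.toLabelled.HasLinearGrowth)
    (hsym : S.toLabelled.IsSymmetric) (h : OSReconstructionNoE1 S.toLabelled) :
    Dense ((Submodule.span ℂ
      {ψ : h.Hilbert | ∃ (m : ℕ) (G : 𝓢((Fin m → E4), ℂ)) (hG : IsTimeOrdered G),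
        tsupport (G : (Fin m → E4) → ℂ) ⊆
          {x | (∀ i, |x i 1| < x i 0) ∧ ∀ i j, i < j → |x j 1 - x i 1| < x j 0 - x i 0} ∧
        ψ = h.fieldVec m (fun _ => ()) G hG} : Submodule ℂ h.Hilbert) : Set h.Hilbert) :=
  stub_density_of_parts stub_oneGap stub_windowedDensity S hlg hsym h

/-- **Stub 4 — LINEARITY: null sets of joint spectral measures pass to the closed span** (the card's
step (3), budgeted as its own stub on the triage's advice r1-1/2/3). For ANY labelled family with E2
and translation invariance on `⁰𝒮` (any labels, any dimension), a Borel set `N` of energy–momentum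
space that is null for every joint spectral measure of every vector of a set `D` of dense linear span
is null for every joint spectral measure of every vector. Why true: joint spectral measures EXIST
(`OSReconstructionNoE1Proofs.exists_isJointSpectralMeasure_holds`) and are UNIQUE — a finite measure
on `{p₀ ≥ 0}` is determined by `∫ e^{-tp₀ + i⟨a,p⟩} dμ`, `t ≥ 0`, `a ⊥ e₀` (Fourier uniqueness in
`p⃗`, Mathlib `Measure.ext_of_charFun`, then Laplace uniqueness on `[0,∞)` for each spatial Borel
slab; not in the tree, part of the budget); and `μ_ψ(N) = ‖P(Ñ)ψ‖²` for the projection-valued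
measure `P` of the unitary group `W(b) = e^{ib⁰A}U(b⃗)`, `A = e^{-H}` (the Bochner measure of
`SemigroupJointSpectralMeasure` pushed forward by `q ↦ (-log λ(q), q⃗)`), so
`ψ ↦ μ_ψ(N)^{1/2}` is a continuous Hilbert seminorm (parallelogram law
`μ_{ψ+φ} + μ_{ψ-φ} = 2μ_ψ + 2μ_φ` on `N`, `μ_ψ(N) ≤ ‖ψ‖²` by `measureReal_univ`) whose kernel is a
CLOSED SUBSPACE containing `D`, hence `span D`, hence its closure. A PVM-free Lean route: polarise
the Bochner measures into complex measures `μ_{φ,ψ}` (sesquilinear by uniqueness), bound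
`|μ_{φ,ψ}(N)|² ≤ μ_φ(N) μ_ψ(N)` (Cauchy–Schwarz for the positive sesquilinear form
`(φ,ψ) ↦ μ_{φ,ψ}(N)`), and close up. Size M. -/
theorem stub_linearity {ι : Type*} {d : ℕ} [NeZero d]
    {S : LabelledSchwingerFamily ι (EuclideanSpace ℝ (Fin d))} (h : OSReconstructionNoE1 S)
    {N : Set (EuclideanSpace ℝ (Fin d))} (hN : MeasurableSet N) {D : Set h.Hilbert}
    (hD : Dense ((Submodule.span ℂ D : Submodule ℂ h.Hilbert) : Set h.Hilbert))
    (hDN : ∀ ψ ∈ D, ∀ μ : Measure (EuclideanSpace ℝ (Fin d)), h.IsJointSpectralMeasure ψ μ → μ N = 0)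
    (ψ : h.Hilbert) (μ : Measure (EuclideanSpace ℝ (Fin d))) (hμ : h.IsJointSpectralMeasure ψ μ) :
    μ N = 0 := by
  sorry

/-- **Stub 5 — TRANSFER `C⁺ ⇒ C`: the operator cone gives the typed tube statement for ALL
time-ordered pairs** (the card's Transfer, "EASIER because asymptotic, delay/constant-blind and
linear"; the converse `C ⇒ C⁺` is stubs 2+4 applied to all `Ψ_G`, so nothing is lost). If every
joint spectral measure of every vector of the `e₀`-OS space of `S` is carried by `{p₀ ≥ |p₁|}`, then
for time-ordered `F` (`n` points), `G` (`m` points) there is `Φ` holomorphic on `{|Im β| < Re ζ}`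
with `Φ(t,b) = 𝔖_{n+m}(ΘF* ⊗ G_{te₀+be₁})` (any tensor witness) and
`‖Φ(ζ,β)‖² ≤ ‖𝔖_{2n}(ΘF*⊗F)‖ ‖𝔖_{2m}(ΘG*⊗G)‖`. Why true: `g_ψ(ζ,β) := ∫ e^{-ζp₀+iβp₁} dμ_ψ`
(μ_ψ exists: `exists_isJointSpectralMeasure_holds`) converges absolutely on the tube because
`Re(-ζp₀+iβp₁) ≤ -(Re ζ - |Im β|) p₀ ≤ 0` on the cone, is holomorphic there (differentiation under
the integral, `p₀ e^{-δp₀}` bounded) with `|g_ψ| ≤ μ_ψ(univ) = ‖ψ‖²` (`measureReal_univ`); polarise,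
`Φ := ¼ Σ_k i^{-k} g_{Ψ_F + i^k Ψ_G}`; at real `(t,b)`, `t > 0`:
`g_ψ(t,b) = ⟪ψ, e^{-tH}U(be₁)ψ⟫` (`IsJointSpectralMeasure.inner_transfer_translate` with
`a = b e₁`, `⟪b e₁, p⟫ = b p₁`) so `Φ(t,b) = ⟪Ψ_F, e^{-tH}U(be₁)Ψ_G⟫` (`inner_map_polarization'`)
`= 𝔖_{n+m}(ΘF* ⊗ G_{te₀+be₁})` (`transfer_fieldVec`, `translate_fieldVec`,
`translateMulti_translateMulti`, `inner_fieldVec_fieldVec`; `S.toLabelled _ k = S _`); the bound at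
COMPLEX points is the semigroup square `e^{-ζH+iβP₁} = B* B'` with
`B = e^{-(ζ̄/2)H - i(β̄/2)P₁}`, `B' = e^{-(ζ/2)H+i(β/2)P₁}`, `‖B'ψ‖² = g_ψ(Re ζ, i Im β) ≤ ‖ψ‖²` — in
Lean either through a bounded Borel functional calculus of the commuting pair
`(e^{-H}, U(·e₁))` (SNAG-type PVM from `SemigroupJointSpectralMeasure`'s Bochner measures; or
Gelfand duality on the commutative C*-algebra they generate, Mathlib `gelfandStarTransform`) or
through the Kolmogorov factorisation of the positive-semidefinite kernel
`((ζ,β,ψ),(ζ',β',ψ')) ↦ polarised g(ζ̄+ζ', β'-β̄)` on (half-tube) × ℋ (tree pattern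
`Literature.Analysis.Complex.IsPosSemidefKernelOn`, `SesquiHolomorphicPairing`), whose vectors at
real points are `e^{-tH/2}U(be₁/2)ψ ∈ ℋ`. Degenerate cases (cdisprove `crux_at_zero`,
`crux_at_vacuumOnly`; refuter g41-34 junk audit): `n = 0` or `m = 0` give constant `Φ` and the 2×2
Gram bound incl. `𝔖₀`, no normalisation used; `‖𝔖_{2n}(ΘF*⊗F)‖ = ‖Ψ_F‖²` by `inner_fieldVec_fieldVec`.
Size L. -/
theorem stub_transfer (S : SchwingerFamily E4) (h : OSReconstructionNoE1 S.toLabelled)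
    (hcone : ∀ (ψ : h.Hilbert) (μ : Measure E4), h.IsJointSpectralMeasure ψ μ →
      μ {p | p 0 < |p 1|} = 0)
    (n m : ℕ) (F : 𝓢((Fin n → E4), ℂ)) (G : 𝓢((Fin m → E4), ℂ))
    (hF : IsTimeOrdered F) (hG : IsTimeOrdered G) :
    ∃ Φ : ℂ × ℂ → ℂ, DifferentiableOn ℂ Φ {w : ℂ × ℂ | |w.2.im| < w.1.re} ∧
      (∀ (t b : ℝ), 0 < t → ∀ H : 𝓢((Fin (n + m) → E4), ℂ),
        IsAppendTensorOf H (osAdjoint F)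
            (translateMulti (t • EuclideanSpace.single 0 1 + b • EuclideanSpace.single 1 1) G) →
          Φ ((t : ℂ), (b : ℂ)) = S (n + m) H) ∧
      (∀ w ∈ {w : ℂ × ℂ | |w.2.im| < w.1.re},
        ∀ (HF : 𝓢((Fin (n + n) → E4), ℂ)) (HG : 𝓢((Fin (m + m) → E4), ℂ)),
          IsAppendTensorOf HF (osAdjoint F) F → IsAppendTensorOf HG (osAdjoint G) G →
            ‖Φ w‖ ^ 2 ≤ ‖S (n + n) HF‖ * ‖S (m + m) HG‖) := by
  sorry

/-! ## Glue (sorry-free, kernel-checked) -/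

/-- The pull-back by the identity frame is the family itself (`linActMulti 1 F = F` pointwise). -/
theorem pullback_refl (S : SchwingerFamily E4) :
    (fun n => (S n).comp (linActMulti (LinearIsometryEquiv.refl ℝ E4))) = S := by
  funext n
  refine ContinuousLinearMap.ext fun F => ?_
  have hF : linActMulti (LinearIsometryEquiv.refl ℝ E4) F = F := SchwartzMap.ext fun _ => rfl
  rw [ContinuousLinearMap.comp_apply, hF]

/-- **The `e₀`-frame OS reconstruction exists under the crux hypotheses**: E2 of `S.toLabelled` is
the eight-frame hypothesis at the frame `R = 1` (`a = 1`, `b = 0`; honours cdisprove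
`false_without_axisFrames`: the `e₀` mirror is load-bearing exactly here), translation invariance on
`⁰𝒮` is the crux hypothesis relabelled (`S.toLabelled n k = S n`). -/
theorem osReconstruction_e0 (S : SchwingerFamily E4)
    (htr : ∀ (n : ℕ) (a : E4) (F : 𝓢((Fin n → E4), ℂ)), IsOffDiagonal F →
      S n (translateMulti a F) = S n F)
    (hRP : ∀ (R : E4 ≃ₗᵢ[ℝ] E4) (a b : ℝ), a ^ 2 + b ^ 2 = 1 → (a = 0 ∨ b = 0 ∨ a ^ 2 = b ^ 2) →
      R (EuclideanSpace.single 0 1) = a • EuclideanSpace.single 0 1 + b • EuclideanSpace.single 1 1 →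
        (SchwingerFamily.toLabelled (fun n => (S n).comp (linActMulti R))).IsReflectionPositive) :
    OSReconstructionNoE1 S.toLabelled := by
  refine ⟨?_, fun n k a F hF => htr n a F hF⟩
  have h1 := hRP (LinearIsometryEquiv.refl ℝ E4) 1 0 (by norm_num) (Or.inr (Or.inl rfl)) (by simp)
  rwa [pullback_refl] at h1

/-- The complement `{p₀ < |p₁|}` of the closed planar cone is open, hence Borel. -/
theorem measurableSet_coneCompl : MeasurableSet {p : E4 | p 0 < |p 1|} := by
  have h0 : Continuous fun p : E4 => p 0 := by fun_prop
  have h1 : Continuous fun p : E4 => |p 1| := by fun_prop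
  exact (isOpen_lt h0 h1).measurableSet

/-- `⟪b e₁, p⟫ = b p₁` — matches the Fourier phase of `IsJointSpectralMeasure` at `a = b e₁` with the
integrand of stub 2. -/
theorem inner_single_one (b : ℝ) (p : E4) :
    ⟪EuclideanSpace.single (1 : Fin 4) b, p⟫_ℝ = b * p 1 := by
  simp [EuclideanSpace.inner_single_left]

/-- **ARROW FORM — stubs 1–4 ⇒ the transfer target `C⁺`.** With the statements of
`stub_discSections`, `stub_cone_of_discSections`, `stub_density`, `stub_linearity` as HYPOTHESES
(verbatim), every joint spectral measure of every vector of the `e₀`-OS space of a family with the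
crux hypotheses is carried by the closed planar cone `{p₀ ≥ |p₁|}`. Proof = the line: linearity
reduces to the cone-chain vectors `Ψ_G` (dense by stub 3); for those, stub 1 gives disc sections of
`⟪Ψ_G, e^{-tH}U(be₁)Ψ_G⟫ = ∫ e^{-tp₀+ibp₁} dμ` (`IsJointSpectralMeasure.inner_transfer_translate`,
`inner_single_one`), and stub 2 turns them into cone support (`energy_nonneg`, `isFiniteMeasure`
are fields of `IsJointSpectralMeasure`). -/
theorem planarConeSupport_of_parts
    (h_disc : ∀ (S : SchwingerFamily E4), S.toLabelled.HasLinearGrowth → S.toLabelled.IsSymmetric →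
      (∀ (n : ℕ) (a : E4) (F : 𝓢((Fin n → E4), ℂ)), IsOffDiagonal F →
        S n (translateMulti a F) = S n F) →
      (∀ (R : E4 ≃ₗᵢ[ℝ] E4) (a b : ℝ), a ^ 2 + b ^ 2 = 1 → (a = 0 ∨ b = 0 ∨ a ^ 2 = b ^ 2) →
        R (EuclideanSpace.single 0 1) = a • EuclideanSpace.single 0 1 + b • EuclideanSpace.single 1 1 →
          (SchwingerFamily.toLabelled (fun n => (S n).comp (linActMulti R))).IsReflectionPositive) →
      ∀ (h : OSReconstructionNoE1 S.toLabelled) {m : ℕ} (G : 𝓢((Fin m → E4), ℂ))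
        (hG : IsTimeOrdered G),
        tsupport (G : (Fin m → E4) → ℂ) ⊆
          {x | (∀ i, |x i 1| < x i 0) ∧ ∀ i j, i < j → |x j 1 - x i 1| < x j 0 - x i 0} →
        ∃ c M : ℝ, 0 ≤ c ∧ ∀ t : ℝ, c < t → ∃ f : ℂ → ℂ,
          DifferentiableOn ℂ f (Metric.ball 0 (t - c)) ∧
            (∀ z ∈ Metric.ball (0 : ℂ) (t - c), ‖f z‖ ≤ M) ∧
              ∀ b : ℝ, |b| < t - c →
                f b = ⟪h.fieldVec m (fun _ => ()) G hG, h.transfer t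
                  (h.translate (EuclideanSpace.single 1 b) (h.fieldVec m (fun _ => ()) G hG))⟫_ℂ)
    (h_cone : ∀ (μ : Measure E4) [IsFiniteMeasure μ], μ {p | p 0 < 0} = 0 → ∀ (c M : ℝ), 0 ≤ c →
      (∀ t : ℝ, c < t → ∃ f : ℂ → ℂ,
        DifferentiableOn ℂ f (Metric.ball 0 (t - c)) ∧
          (∀ z ∈ Metric.ball (0 : ℂ) (t - c), ‖f z‖ ≤ M) ∧
            ∀ b : ℝ, |b| < t - c →
              f b = ∫ p, Complex.exp ((((-(t * p 0) : ℝ)) : ℂ) + ((b * p 1 : ℝ) : ℂ) * Complex.I) ∂μ) →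
      μ {p | p 0 < |p 1|} = 0)
    (h_dense : ∀ (S : SchwingerFamily E4), S.toLabelled.HasLinearGrowth → S.toLabelled.IsSymmetric →
      ∀ (h : OSReconstructionNoE1 S.toLabelled),
        Dense ((Submodule.span ℂ
          {ψ : h.Hilbert | ∃ (m : ℕ) (G : 𝓢((Fin m → E4), ℂ)) (hG : IsTimeOrdered G),
            tsupport (G : (Fin m → E4) → ℂ) ⊆
              {x | (∀ i, |x i 1| < x i 0) ∧ ∀ i j, i < j → |x j 1 - x i 1| < x j 0 - x i 0} ∧
            ψ = h.fieldVec m (fun _ => ()) G hG} : Submodule ℂ h.Hilbert) : Set h.Hilbert))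
    (h_lin : ∀ {ι : Type} {d : ℕ} [NeZero d]
      {S : LabelledSchwingerFamily ι (EuclideanSpace ℝ (Fin d))} (h : OSReconstructionNoE1 S)
      {N : Set (EuclideanSpace ℝ (Fin d))}, MeasurableSet N → ∀ {D : Set h.Hilbert},
        Dense ((Submodule.span ℂ D : Submodule ℂ h.Hilbert) : Set h.Hilbert) →
        (∀ ψ ∈ D, ∀ μ : Measure (EuclideanSpace ℝ (Fin d)), h.IsJointSpectralMeasure ψ μ →
          μ N = 0) →
          ∀ (ψ : h.Hilbert) (μ : Measure (EuclideanSpace ℝ (Fin d))),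
            h.IsJointSpectralMeasure ψ μ → μ N = 0)
    (S : SchwingerFamily E4) (hlg : S.toLabelled.HasLinearGrowth) (hsym : S.toLabelled.IsSymmetric)
    (htr : ∀ (n : ℕ) (a : E4) (F : 𝓢((Fin n → E4), ℂ)), IsOffDiagonal F →
      S n (translateMulti a F) = S n F)
    (hRP : ∀ (R : E4 ≃ₗᵢ[ℝ] E4) (a b : ℝ), a ^ 2 + b ^ 2 = 1 → (a = 0 ∨ b = 0 ∨ a ^ 2 = b ^ 2) →
      R (EuclideanSpace.single 0 1) = a • EuclideanSpace.single 0 1 + b • EuclideanSpace.single 1 1 →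
        (SchwingerFamily.toLabelled (fun n => (S n).comp (linActMulti R))).IsReflectionPositive)
    (h : OSReconstructionNoE1 S.toLabelled) (ψ : h.Hilbert) (μ : Measure E4)
    (hμ : h.IsJointSpectralMeasure ψ μ) :
    μ {p | p 0 < |p 1|} = 0 := by
  refine h_lin h measurableSet_coneCompl (h_dense S hlg hsym h) ?_ ψ μ hμ
  rintro ψ' ⟨m, G, hG, hC, rfl⟩ μ' hμ'
  obtain ⟨c, M, hc, hdisc⟩ := h_disc S hlg hsym htr hRP h G hG hC
  haveI := hμ'.isFiniteMeasure
  refine h_cone μ' hμ'.energy_nonneg c M hc fun t ht => ?_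
  obtain ⟨f, hf, hfM, hfb⟩ := hdisc t ht
  refine ⟨f, hf, hfM, fun b hb => ?_⟩
  rw [hfb b hb, hμ'.inner_transfer_translate t (hc.trans_lt ht).le (EuclideanSpace.single 1 b)
    (by simp)]
  simp_rw [inner_single_one]

/-- **THE CRUX FROM THE LINE, BY NAME** — `MirrorModularBoosts.PlanarSpectralCone` from the five
stubs and nothing else: build the `e₀`-OS space (`osReconstruction_e0`), get the transfer target `C⁺`
from stubs 1–4 (`planarConeSupport_of_parts`), and conclude with stub 5. No hypotheses; the only
`sorry`s in its cone are the five `stub_*`. -/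
theorem PlanarSpectralCone_of :
    Summit.QuantumFields.YangMills.Theses.MirrorModularBoosts.PlanarSpectralCone := by
  intro S hlg hsym htr hRP n m F G hF hG
  have h : OSReconstructionNoE1 S.toLabelled := osReconstruction_e0 S htr hRP
  exact stub_transfer S h
    (planarConeSupport_of_parts stub_discSections stub_cone_of_discSections stub_density
      stub_linearity S hlg hsym htr hRP h) n m F G hF hG

end Summit.QuantumFields.YangMills.Cruxes.PlanarSpectralCone.PositivityDiscToOperatorCone
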